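import Literature.NumberTheory.EllipticCurves.ComplexMultiplicationBurungaleFlachDescentThreeLeavesProofs
import HarnessLib

/-!
# bsd.S28 (Burungale–Flach): Corollary 1 over the CM field from three leaves, after Deuring

Proof sibling (D-0014 append protocol: a new file, theorems only, no definition, no named fact
introduced or restated) of `ComplexMultiplicationBurungaleFlachDescent.lean` for its named fact

> `Literature.NumberTheory.EllipticCurves.BurungaleFlach2024_bsd_cmField` — Burungale–Flach,
> Camb. J. Math. 12 (2024), **Corollary 1** ("BSD for `E/F`") at `F = K`, for the base change
> `E_K` of a CM curve `E/ℚ` with `j(E) ∈ maximalCMJInvariants` and `L(E/ℚ, 1) ≠ 0`: `E(K)` and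
> `Ш(E_K/K)` are finite and `L(E_K/K, 1)/Ω(E_K) = #Ш(E_K/K) / #E(K)² · ∏_v c_v`,

and of `ComplexMultiplicationBurungaleFlachCorOneLeavesProofs.lean` (six classical leaves) and
`ComplexMultiplicationBurungaleFlachSevenLeavesProofs.lean`
(`BurungaleFlach2024_bsd_cmField_of_four_leaves`: Prop. 2.3 with Lemma 13, Rubin 1987 §10,
Coates–Wiles 1977 §6, Deuring). Since the latter was written, **Deuring's identity
`L(E_K/K, s) = L(E/ℚ, s)²` has become a theorem of the tree**
(`Deuring_LFunction_baseChange_cmField_holds`, `ComplexMultiplicationDeuringHoldsProofs`: Artin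
formalism for quadratic base change `LSeries_baseChange_quadratic_holds`, the certified CM twist
isogeny `E ∼ E^{(d_K)}` and Knapp 11.67, all three discharged). This file records the resulting
trust base of Corollary 1 over `K` and of the statements assembled through it — nothing is added,
one leaf is gone everywhere:

* `BurungaleFlach2024_finite_primary_cmField_of_two_leaves` (**proved**): the finiteness half of
  Theorem 1.1 at `F = K` (Prop. 4.1: `E(K)` and `Ш(E_K/K)[p^∞]` finite for all `p`) from
  Coates–Wiles 1977 §6 (`h1`) and Rubin 1987 §10 (`hR`) — Remark 10 of the paper for `F = L = K`;
* `BurungaleFlach2024_main_cmField_of_three_leaves`, `…_iff_pPart_of_two_leaves` (**proved**):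
  Theorem 1.1 with Remark 1 at `F = K` from Prop. 2.3 with Lemma 13 (`hB`), `hR`, `h1`; and,
  modulo `hR`, `h1`, Theorem 1.1 over `K` ⇔ its formula half `hB`;
* `BurungaleFlach2024_bsd_cmField_of_printed_halves` (**proved**): Corollary 1 over `K` from the
  two printed halves of the proof of Theorem 1.1 (Prop. 4.1 `hA`; Prop. 2.3 with Lemma 13 `hB`)
  and nothing else — the printed three-line proof of Cor. 1 (Shimura 7.42 / Deuring,
  `N_{K/ℚ}|A|_K = |A|`, (periodnorm)) being now entirely a theorem
  (`BurungaleFlach2024_bsd_cmField_of_main_of_Deuring` with `…_holds`);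
* `BurungaleFlach2024_bsd_cmField_of_three_leaves` (**proved**, the census of this fact):
  Corollary 1 over `K` follows, sorry-free, from exactly **three** named facts —
  1. `BurungaleFlach2024_main_cmField_pPart` (`hB`) — Prop. 2.3 with Lemma 13 at `F = K` for
     every `p`: the paper's contribution (Johnson-Leung–Kings' two-variable main conjecture
     Thm. 4.1, the descent Prop. 4.1, Kato's explicit reciprocity law Prop. 3.1 / Cor. 9);
  2. `Rubin1987_sha_primary_finite` (`hR`) — Rubin, Invent. Math. 89 (1987), §10;
  3. `CoatesWiles1977_L_one_div_period_mem_prime` (`h1`) — Coates–Wiles, Invent. Math. 39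
     (1977), §6;
  so that the discharge `BurungaleFlach2024_bsd_cmField_holds` is the term
  `BurungaleFlach2024_bsd_cmField_of_three_leaves hB_holds hR_holds h1_holds` the day the three
  are theorems (triage unchanged: each is a `𝔭`-adic theory — SIZE XL);
* `BurungaleFlach2024_bsd_rat_of_six_leaves`,
  `bsdTriple_of_j_mem_maximalCMJInvariants_of_L_one_ne_zero_of_six_leaves` (**proved**):
  Corollary 2 over `ℚ` (`BurungaleFlach2024_bsd_rat`) and bsd.S28
  (`bsdTriple_of_j_mem_maximalCMJInvariants_of_L_one_ne_zero`, the full rank-zero BSD statement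
  for `E/ℚ` with CM by `𝓞_K` and `L(E, 1) ≠ 0`) from **six** named facts: the three above and the
  three of the descent (`bsdRHS_baseChange_quadratic` — Milne 1972 Thm. 1, rank-zero quotient
  form; `bsdRHS_eq_of_isIsogenous` — Cassels 1965 / Milne *ADT* I.7.3;
  `re_entireLFunction_one_nonneg` — `L(E,1) ≥ 0`, Guo 1996 / Lapid–Rallis 2003), i.e. the seven
  of `…_of_seven_leaves` minus Deuring.

## References

* A. Burungale, M. Flach, *The conjecture of Birch and Swinnerton-Dyer for certain elliptic curves
  with complex multiplication*, Camb. J. Math. 12 (2024), no. 2 (arXiv:2206.09874): Thm. 1.1 and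
  Remark 1 (p. 3), Cor. 1 and its proof (p. 3), Cor. 2, its proof and the sentence following it
  (p. 4), Prop. 2.3 (p. 12), Prop. 4.1 and Remark 10 (p. 19), Lemma 13 and the proof of Thm. 1.1
  (p. 22). [BurungaleFlach2024]
* J. Coates, A. Wiles, *On the conjecture of Birch and Swinnerton-Dyer*, Invent. Math. 39 (1977),
  Thm. 1 and §6. [CoatesWiles1977]
* K. Rubin, *Tate–Shafarevich groups and L-functions of elliptic curves with complex
  multiplication*, Invent. Math. 89 (1987), Thm. A, §10. [Rubin1987Sha]
* J. S. Milne, *On the arithmetic of abelian varieties*, Invent. Math. 17 (1972), Thm. 1, Thm. 3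
  and Corollary. [Milne1972ArithmeticAV]
* J. H. Silverman, *Advanced Topics in the Arithmetic of Elliptic Curves*, GTM 151 (1994), Ch. II
  Thm. 10.5 (Deuring; the leaf discharged upstream). [SilvermanATAEC1994]
-/

noncomputable section

open WeierstrassCurve

namespace Literature.NumberTheory.EllipticCurves

/-! ### The finiteness half of Theorem 1.1 over `K` from two leaves -/

/-- **Burungale–Flach 2024, Prop. 4.1 (finiteness half) at `F = K`, from Coates–Wiles 1977 §6 and
Rubin 1987 §10 only.** `E(K)` and `Ш(E_K/K)[p^∞]` (all `p`) are finite for `E/ℚ` with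
`j(E) ∈ maximalCMJInvariants`, `L(E/ℚ,1) ≠ 0` and `K` its CM field, on any globally minimal model
of `E_K`: the three-leaf census `BurungaleFlach2024_finite_primary_cmField_of_three_leaves` with
its Deuring leaf supplied by the theorem `Deuring_LFunction_baseChange_cmField_holds`. This is
Remark 10 of the paper (*"the finiteness of the Mordell–Weil group is due to Coates and Wiles,
Arthaud and Rubin. For `L = K` the finiteness of the Tate–Shafarevich group is due to Rubin"*)
for `F = L = K`. [cite: BurungaleFlach2024, Prop. 4.1 with Remark 10 (arXiv p. 19)]
[cite: CoatesWiles1977, Thm 1 (p. 223); §6 pp. 250–251] [cite: Rubin1987Sha, §10, p. 549] -/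
theorem BurungaleFlach2024_finite_primary_cmField_of_two_leaves
    (h1 : CoatesWiles1977_L_one_div_period_mem_prime) (hR : Rubin1987_sha_primary_finite) :
    BurungaleFlach2024_finite_primary_cmField :=
  BurungaleFlach2024_finite_primary_cmField_of_three_leaves h1 hR
    Deuring_LFunction_baseChange_cmField_holds

/-! ### Theorem 1.1 over `K` from three leaves -/

/-- **Burungale–Flach, Theorem 1.1 with Remark 1 at `F = K`, from three leaves**: Prop. 2.3 with
Lemma 13 at `F = K` for every `p` (`hB`), Rubin 1987 §10 (`hR`) and Coates–Wiles 1977 §6 (`h1`) —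
`BurungaleFlach2024_main_cmField_of_four_leaves` with Deuring's identity discharged.
[cite: BurungaleFlach2024, Thm. 1.1 and Remark 1 (p. 3), proof of Thm. 1.1 (p. 22) with Prop. 2.3, Lemma 13, Prop. 4.1, Remark 10] -/
theorem BurungaleFlach2024_main_cmField_of_three_leaves
    (hB : BurungaleFlach2024_main_cmField_pPart) (hR : Rubin1987_sha_primary_finite)
    (h1 : CoatesWiles1977_L_one_div_period_mem_prime) : BurungaleFlach2024_main_cmField :=
  BurungaleFlach2024_main_cmField_of_four_leaves hB hR h1 Deuring_LFunction_baseChange_cmField_holds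

/-- **Modulo Rubin 1987 §10 and Coates–Wiles 1977 §6, Theorem 1.1 at `F = K` is equivalent to its
formula half** `BurungaleFlach2024_main_cmField_pPart` (Prop. 2.3 with Lemma 13 at `F = K` for
every `p`) — `BurungaleFlach2024_main_cmField_iff_pPart_of_three_leaves` with Deuring discharged.
[cite: BurungaleFlach2024, proof of Thm. 1.1 (p. 22) with Prop. 2.3 and Lemma 13] -/
theorem BurungaleFlach2024_main_cmField_iff_pPart_of_two_leaves
    (hR : Rubin1987_sha_primary_finite) (h1 : CoatesWiles1977_L_one_div_period_mem_prime) :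
    BurungaleFlach2024_main_cmField ↔ BurungaleFlach2024_main_cmField_pPart :=
  BurungaleFlach2024_main_cmField_iff_pPart_of_three_leaves hR h1
    Deuring_LFunction_baseChange_cmField_holds

/-! ### Corollary 1 over `K` -/

/-- **Corollary 1 at `F = K` from the two printed halves of the proof of Theorem 1.1 and nothing
else**: Prop. 4.1 at `F = K` (`hA`: `E(K)`, `Ш(E_K/K)[p^∞]` finite) and Prop. 2.3 with Lemma 13
at `F = K` (`hB`: the `{𝔭 ∣ p}`-part of the `𝓞_K`-equivariant formula, all `p`). The rest of the
printed argument — the last paragraph of the proof of Thm. 1.1 (local–global passage,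
`BurungaleFlach2024_main_cmField_of_halves`) and the three-line proof of Cor. 1 (Shimura
7.42 / Deuring `L(E_K/K,1) = L(E/ℚ,1)²`, `N_{K/ℚ}|A|_K = |A|`, (periodnorm) `Ω(E_K) = |Ω|²`,
`BurungaleFlach2024_bsd_cmField_of_main_of_Deuring`) — is a theorem of the tree, Deuring's
identity included (`Deuring_LFunction_baseChange_cmField_holds`).
[cite: BurungaleFlach2024, Cor. 1 and its proof (p. 3), proof of Thm. 1.1 (p. 22)] -/
theorem BurungaleFlach2024_bsd_cmField_of_printed_halves
    (hA : BurungaleFlach2024_finite_primary_cmField) (hB : BurungaleFlach2024_main_cmField_pPart) :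
    BurungaleFlach2024_bsd_cmField :=
  BurungaleFlach2024_bsd_cmField_of_printed_leaves_of_Deuring hA hB
    Deuring_LFunction_baseChange_cmField_holds

/-- **Census: Burungale–Flach's Corollary 1 at `F = K` rests on exactly three named facts** —
Prop. 2.3 with Lemma 13 at `F = K` for every `p` (`hB`, the paper's Iwasawa-theoretic
contribution), Rubin 1987 §10 (`hR`) and the `𝔭`-divisibility of `Ω⁻¹L(E/ℚ,1)` of Coates–Wiles
1977 §6 (`h1`); everything else in the printed proofs of Thm. 1.1 (last paragraph), Cor. 1 and
Remark 10 at `F = K` — Deuring's `L(E_K/K,s) = L(E/ℚ,s)²`, the CM period lattice `Λ_E = Ω𝓞_K`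
(nine singular moduli), class number one, Mordell–Weil, the quadratic descent of finiteness, the
CM twist isogeny, Knapp 11.67, the local–global passage and the norm computation — being
theorems of the tree. `BurungaleFlach2024_bsd_cmField_of_four_leaves` with Deuring discharged;
the discharge of the fact is this theorem applied to the three `…_holds` the day they exist.
[cite: BurungaleFlach2024, Cor. 1 and its proof (p. 3), Thm. 1.1 and its proof (pp. 3, 22), Remark 10 (p. 19)]
[cite: CoatesWiles1977, §6 pp. 250–251] [cite: Rubin1987Sha, §10, p. 549] -/
theorem BurungaleFlach2024_bsd_cmField_of_three_leaves
    (hB : BurungaleFlach2024_main_cmField_pPart) (hR : Rubin1987_sha_primary_finite)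
    (h1 : CoatesWiles1977_L_one_div_period_mem_prime) : BurungaleFlach2024_bsd_cmField :=
  BurungaleFlach2024_bsd_cmField_of_printed_halves
    (BurungaleFlach2024_finite_primary_cmField_of_two_leaves h1 hR) hB

/-! ### Corollary 2 over `ℚ` and bsd.S28 from six leaves -/

/-- **Corollary 2 over `ℚ` from six leaves** (Burungale–Flach 2024, Cor. 2 at `F⁺ = ℚ`:
rank-zero BSD for `E/ℚ` with CM by `𝓞_K` and `L(E,1) ≠ 0`, `BurungaleFlach2024_bsd_rat`):
Corollary 1 over `K` from its three leaves (`hB`, `hR`, `h1`) fed into the three-leaf descent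
`BurungaleFlach2024_bsd_rat_of_corOne_of_three_leaves` (Milne 1972 Thm. 1 in quotient form
`hBC`, Cassels' isogeny invariance `hISO`, `L(E,1) ≥ 0` `hPOS`).
[cite: BurungaleFlach2024, Cor. 2 and its proof (p. 4)]
[cite: Milne1972ArithmeticAV, Thm. 1, Thm. 3 and Corollary (through BurungaleFlach2024)] -/
theorem BurungaleFlach2024_bsd_rat_of_six_leaves
    (hB : BurungaleFlach2024_main_cmField_pPart) (hR : Rubin1987_sha_primary_finite)
    (h1 : CoatesWiles1977_L_one_div_period_mem_prime)
    (hBC : bsdRHS_baseChange_quadratic) (hISO : bsdRHS_eq_of_isIsogenous)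
    (hPOS : re_entireLFunction_one_nonneg) : BurungaleFlach2024_bsd_rat :=
  BurungaleFlach2024_bsd_rat_of_corOne_of_three_leaves
    (BurungaleFlach2024_bsd_cmField_of_three_leaves hB hR h1) hBC hISO hPOS

/-- **bsd.S28 from six leaves.** The full rank-zero Birch–Swinnerton-Dyer statement for `E/ℚ`
with CM by `𝓞_K` and `L(E,1) ≠ 0` (`bsdTriple_of_j_mem_maximalCMJInvariants_of_L_one_ne_zero`;
Burungale–Flach 2024, Thm. 1.1, Cor. 1, Cor. 2) follows, sorry-free, from

1. `BurungaleFlach2024_main_cmField_pPart` (`hB`) — Prop. 2.3 with Lemma 13 at `F = K`, all `p`;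
2. `Rubin1987_sha_primary_finite` (`hR`) — Rubin 1987, §10;
3. `CoatesWiles1977_L_one_div_period_mem_prime` (`h1`) — Coates–Wiles 1977, §6;
4. `bsdRHS_baseChange_quadratic` (`hBC`) — Milne 1972, Thm. 1, rank-zero quotient form;
5. `bsdRHS_eq_of_isIsogenous` (`hISO`) — Cassels 1965 / Milne *ADT* I.7.3;
6. `re_entireLFunction_one_nonneg` (`hPOS`) — `L(E, 1) ≥ 0` (Guo 1996; Lapid–Rallis 2003):

`bsdTriple_of_j_mem_maximalCMJInvariants_of_L_one_ne_zero_of_seven_leaves` with its Deuring leaf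
supplied by `Deuring_LFunction_baseChange_cmField_holds`; nothing added.
[cite: BurungaleFlach2024, Thm. 1.1 and its proof, Cor. 1, Cor. 2, Remark 10 (arXiv pp. 3–4, 19, 22)] -/
theorem bsdTriple_of_j_mem_maximalCMJInvariants_of_L_one_ne_zero_of_six_leaves
    (hB : BurungaleFlach2024_main_cmField_pPart) (hR : Rubin1987_sha_primary_finite)
    (h1 : CoatesWiles1977_L_one_div_period_mem_prime)
    (hBC : bsdRHS_baseChange_quadratic) (hISO : bsdRHS_eq_of_isIsogenous)
    (hPOS : re_entireLFunction_one_nonneg) :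
    bsdTriple_of_j_mem_maximalCMJInvariants_of_L_one_ne_zero :=
  bsdTriple_of_j_mem_maximalCMJInvariants_of_L_one_ne_zero_of_seven_leaves hB hR h1
    Deuring_LFunction_baseChange_cmField_holds hBC hISO hPOS

end Literature.NumberTheory.EllipticCurves

end
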